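import Summits.AtomisticToContinuum.BoseEinsteinCondensation.Theses.BECSubharmonicContinuation
import Literature.MathematicalPhysics.QuantumManyBody.PeriodicBoseGasFracEnergy
import Literature.MathematicalPhysics.QuantumManyBody.PeriodicCondensateCoherence
import Literature.MathematicalPhysics.QuantumManyBody.InsertionStateIdentities
import Literature.MathematicalPhysics.QuantumManyBody.PeriodicFormDomain
import Summits.AtomisticToContinuum.BoseEinsteinCondensation.Theorems.BECConjugateDominationIMUChainGlueKernelBound
import Summits.AtomisticToContinuum.BoseEinsteinCondensation.Theorems.BECThomsonPrincipleGDTransferLnssAlgebraOps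

/-!
# Route BECSubharmonicContinuation — support `FourierRepresentation`: cell toolkit

Helper file (supports item stmt-AtomisticToContinuum-9001, decl `FourierRepresentation` of
route-AtomisticToContinuum-BECSubharmonicContinuation, sub-problem BoseEinsteinCondensation).
One-particle Fourier analysis on the cell `[0,L)³` and slice bookkeeping used by the momentum
representation of the translation-averaged one-body density matrix
(`BECSubharmonicContinuationFourierRepresentation.lean`):

* `cellFourierCoeff_translate` — the translation rule `ĉₙ(φ(· + y)) = e_n(y) ĉₙ(φ)` for
  `Lℤ³`-periodic `φ` (Haar invariance on `(ℝ/ℤ)³`, `mFourierCoeff_comp_add_right`);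
* `hasSum_normSq_cellFourierCoeff_mul_cellWave` / `…_mul_cos` — the polarised Parseval identity
  for a translate, `∑ₙ |ĉₙ(φ)|² cos(2π n·y/L) = L⁻³ Re ∫ conj(φ(x+y)) φ(x) dx` for EVERY `y` (an
  identity of `L²` inner products — no pointwise convergence of Fourier series is involved), from
  the inner-product Parseval identity on the cell already in the tree
  (`IMUChainGlue.hasSum_conj_cellFourierCoeff_mul`, Mathlib's `UnitAddTorus.hasSum_prod_mFourierCoeff`
  transported to the cell);
* slices at the first particle: the linear chain rule `fderiv_slice_apply`, the relabelling rule
  `fderiv_comp_perm` for Bose-symmetric functions, periodicity of the derivative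
  `fderiv_periodic_add_single`, measurability of slice pairings, and the occupations of the
  normalised plane waves through the slice coefficients
  `cellOccupation_planeWaveMode_eq_lintegral_coeff`, finite for continuous functions
  (`cellOccupation_planeWaveMode_ne_top`). (Relabelling invariance of the Bochner integral on
  `cell^N` is reused from the tree: `Lnss.setIntegral_cellN_comp_perm`.)

References: [LSSY2005, §1.2 (1.17)–(1.18)], [Fournais2020, (1.3)–(1.5), (3.19)–(3.21)].
-/

noncomputable section

open MeasureTheory Filter Set WithLp Complex
open scoped ENNReal NNReal Topology ComplexConjugate BigOperators

namespace Summit.AtomisticToContinuum.BoseEinsteinCondensation.Theorems.SubharmonicContinuation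

open Literature.MathematicalPhysics.QuantumManyBody.BoseGas

/-! ### One-particle Fourier analysis on the cell: translates and the polarised Parseval identity -/

section CellFourier

variable {L : ℝ}

/-- The induced torus function of a translate of a periodic function is the translate of the
induced torus function. [folklore] -/
theorem torusFun_translate (hL : 0 < L) {φ : Space → ℂ}
    (hφ : ∀ (x : Space) (k : Fin 3), φ (x + EuclideanSpace.single k L) = φ x) (y : Space)
    (t : UnitAddTorus (Fin 3)) :
    torusFun L (fun x => φ (x + y)) t = torusFun L φ (t + toUnitTorus L y) := by
  have h := torusFun_toUnitTorus hL hφ (fromUnitTorus L t + y)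
  rw [toUnitTorus_add, toUnitTorus_fromUnitTorus hL.ne'] at h
  rw [h]
  rfl

/-- **Translation rule** `ĉₙ(φ(· + y)) = e_n(y) ĉₙ(φ)` for an `Lℤ³`-periodic function on `ℝ³`
(translation invariance of the Haar measure of the torus). [folklore] -/
theorem cellFourierCoeff_translate (hL : 0 < L) {φ : Space → ℂ}
    (hφ : ∀ (x : Space) (k : Fin 3), φ (x + EuclideanSpace.single k L) = φ x) (y : Space)
    (n : Fin 3 → ℤ) :
    cellFourierCoeff L (fun x => φ (x + y)) n = cellWave L n y * cellFourierCoeff L φ n := by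
  unfold cellFourierCoeff
  rw [show torusFun L (fun x => φ (x + y)) = fun t => torusFun L φ (t + toUnitTorus L y) from
    funext (torusFun_translate hL hφ y)]
  exact mFourierCoeff_comp_add_right _ _ _

/-- `Re e_n(y) = cos(2π n·y/L)`. [folklore] -/
theorem re_cellWave (L : ℝ) (n : Fin 3 → ℤ) (y : Space) :
    (cellWave L n y).re = Real.cos (2 * Real.pi * (∑ k, (n k : ℝ) * y k) / L) := by
  rw [cellWave_apply]
  have : (2 * Real.pi * Complex.I * ((∑ k, (n k : ℝ) * y k : ℝ) : ℂ) / (L : ℂ)) =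
      ((2 * Real.pi * (∑ k, (n k : ℝ) * y k) / L : ℝ) : ℂ) * Complex.I := by
    push_cast; ring
  rw [this, Complex.exp_ofReal_mul_I_re]

/-- `Re e_{-n}(y) = cos(2π n·y/L)`. [folklore] -/
theorem re_cellWave_neg (L : ℝ) (n : Fin 3 → ℤ) (y : Space) :
    (cellWave L (-n) y).re = Real.cos (2 * Real.pi * (∑ k, (n k : ℝ) * y k) / L) := by
  rw [← conj_cellWave, Complex.conj_re, re_cellWave]

/-- **Polarised Parseval for a translate**: for a continuous `Lℤ³`-periodic `φ` and every
`y ∈ ℝ³`, `∑ₙ |ĉₙ(φ)|² e_{-n}(y) = L⁻³ ∫_{[0,L)³} conj(φ(x + y)) φ(x) dx` — an identity of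
`L²` inner products, valid for EVERY `y` (no pointwise convergence of the Fourier series is
involved). [folklore] -/
theorem hasSum_normSq_cellFourierCoeff_mul_cellWave (hL : 0 < L) {φ : Space → ℂ}
    (hφ : Continuous φ)
    (hper : ∀ (x : Space) (k : Fin 3), φ (x + EuclideanSpace.single k L) = φ x) (y : Space) :
    HasSum (fun n => ((‖cellFourierCoeff L φ n‖ ^ 2 : ℝ) : ℂ) * cellWave L (-n) y)
      (((L ^ 3)⁻¹ : ℝ) • ∫ x in cell L, conj (φ (x + y)) * φ x) := by
  have hc : Continuous fun x => φ (x + y) := hφ.comp (continuous_id.add continuous_const)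
  refine (IMUChainGlue.hasSum_conj_cellFourierCoeff_mul hL hc hφ).congr_fun fun n => ?_
  rw [cellFourierCoeff_translate hL hper y n, map_mul, conj_cellWave, mul_assoc,
    Complex.conj_mul']
  push_cast
  ring

/-- Real part of `hasSum_normSq_cellFourierCoeff_mul_cellWave`:
`∑ₙ |ĉₙ(φ)|² cos(2π n·y/L) = L⁻³ Re ∫_{[0,L)³} conj(φ(x + y)) φ(x) dx`. [folklore] -/
theorem hasSum_normSq_cellFourierCoeff_mul_cos (hL : 0 < L) {φ : Space → ℂ}
    (hφ : Continuous φ)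
    (hper : ∀ (x : Space) (k : Fin 3), φ (x + EuclideanSpace.single k L) = φ x) (y : Space) :
    HasSum (fun n => ‖cellFourierCoeff L φ n‖ ^ 2 *
        Real.cos (2 * Real.pi * (∑ k, (n k : ℝ) * y k) / L))
      ((L ^ 3)⁻¹ * (∫ x in cell L, conj (φ (x + y)) * φ x).re) := by
  have h := Complex.reCLM.hasSum (hasSum_normSq_cellFourierCoeff_mul_cellWave hL hφ hper y)
  simp only [Complex.reCLM_apply, Complex.re_ofReal_mul, re_cellWave_neg, Complex.smul_re,
    smul_eq_mul] at h
  exact h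

end CellFourier

/-! ### Slices at the first particle -/

section Slices

variable {N n : ℕ} {L : ℝ}

/-- Chain rule for slices, linear form: the derivative of `z ↦ Ψ(update X i z)` at `x` along
`e_k` is the partial derivative `∂_{i,k}Ψ(update X i x)`. [folklore] -/
theorem fderiv_slice_apply {Ψ : Config N → ℂ} (hΨ : Differentiable ℝ Ψ) (X : Config N)
    (i : Fin N) (x : Space) (k : Fin 3) :
    fderiv ℝ (fun z => Ψ (Function.update X i z)) x (EuclideanSpace.single k 1) =
      fderiv ℝ Ψ (Function.update X i x) (Pi.single i (EuclideanSpace.single k 1)) := by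
  have h := hasFDerivAt_update (𝕜 := ℝ) X (i := i) x
  have harg : (ContinuousLinearMap.pi (Pi.single i (ContinuousLinearMap.id ℝ Space)) :
      Space →L[ℝ] Config N) (EuclideanSpace.single k 1) =
        Pi.single i (EuclideanSpace.single k (1 : ℝ)) := by
    funext j
    by_cases hj : j = i
    · subst hj; simp
    · simp [hj]
  rw [show (fun z => Ψ (Function.update X i z)) = Ψ ∘ Function.update X i from rfl,
    fderiv_comp x (hΨ _) h.differentiableAt, h.fderiv, ContinuousLinearMap.comp_apply, harg]

/-- **Relabelling rule for the derivative of a Bose-symmetric function**: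
`DΨ(X) V = DΨ(X ∘ σ) (V ∘ σ)` for every permutation `σ` of the particles (chain rule for the
linear relabelling `X ↦ X ∘ σ`, under which `Ψ` is invariant). [folklore] -/
theorem fderiv_comp_perm {Ψ : Config N → ℂ} (hΨ : Differentiable ℝ Ψ)
    (hsymm : ∀ (σ : Equiv.Perm (Fin N)) (X : Config N), Ψ (X ∘ σ) = Ψ X)
    (σ : Equiv.Perm (Fin N)) (X V : Config N) :
    fderiv ℝ Ψ X V = fderiv ℝ Ψ (X ∘ σ) (V ∘ σ) := by
  set P : Config N →L[ℝ] Config N :=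
    ContinuousLinearMap.pi fun j => (ContinuousLinearMap.proj (σ j) : Config N →L[ℝ] Space)
    with hP
  have hPX : ∀ Z : Config N, P Z = Z ∘ σ := fun Z => rfl
  have hcomp : Ψ ∘ P = Ψ := funext fun Z => by rw [Function.comp_apply, hPX, hsymm]
  have h2 : fderiv ℝ Ψ X = (fderiv ℝ Ψ (P X)).comp P := by
    have := fderiv_comp X (hΨ (P X)) P.differentiableAt
    rwa [hcomp, P.fderiv] at this
  rw [h2, ContinuousLinearMap.comp_apply, hPX, hPX]

/-- The derivative of a periodic trial state is periodic. [folklore] -/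
theorem fderiv_periodic_add_single (Ψ : PeriodicTrialState N L) (X : Config N)
    (i : Fin N) (k : Fin 3) :
    fderiv ℝ Ψ.ψ (X + Pi.single i (EuclideanSpace.single k L)) = fderiv ℝ Ψ.ψ X := by
  have h : (fun Z => Ψ.ψ (Z + Pi.single i (EuclideanSpace.single k L))) = Ψ.ψ :=
    funext fun Z => Ψ.periodic Z i k
  rw [← fderiv_comp_add_right, h]

/-- Measurability in the spectator variables of the slice pairings
`Y ↦ ∫_Ω conj(φ) Φ(·, Y)` (continuous `φ`, `Φ`). [folklore] -/
theorem stronglyMeasurable_sliceInner (L : ℝ) {φ : Space → ℂ} (hφ : Continuous φ)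
    {Φ : Config (n + 1) → ℂ} (hΦ : Continuous Φ) :
    StronglyMeasurable fun Y : Config n => ∫ x in cell L, conj (φ x) * Φ (Matrix.vecCons x Y) := by
  have h : StronglyMeasurable
      (Function.uncurry fun (Y : Config n) (x : Space) => conj (φ x) * Φ (Matrix.vecCons x Y)) := by
    refine Continuous.stronglyMeasurable ?_
    exact (Complex.continuous_conj.comp (hφ.comp continuous_snd)).mul
      (hΦ.comp (continuous_snd.matrixVecCons continuous_fst))
  exact h.integral_prod_right' (ν := volume.restrict (cell L))

/-- **Occupations through the slice Fourier coefficients**: for any `(n+1)`-body function `Φ`,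
`⟨φ_m, γ_Φ φ_m⟩ = (n+1) L³ ∫_{Ω^n} |ĉ_m(Φ(·, Y))|² dY` (`φ_m` the normalised plane wave).
[cite: LSSY2005, §1.2 (1.17)] -/
theorem cellOccupation_planeWaveMode_eq_lintegral_coeff (hL : 0 < L) (Φ : Config (n + 1) → ℂ)
    (m : Fin 3 → ℤ) :
    cellOccupation (n + 1) L (planeWaveMode L m) Φ = (n + 1 : ℝ≥0∞) *
      (ENNReal.ofReal L ^ 3 * ∫⁻ Y in cellN n L,
        (‖cellFourierCoeff L (fun x => Φ (Matrix.vecCons x Y)) m‖₊ : ℝ≥0∞) ^ 2) := by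
  rw [cellOccupation_succ]
  congr 1
  simp only [nnnorm_sq_integral_conj_planeWaveMode_mul hL]
  rw [lintegral_const_mul' _ _ (ENNReal.pow_ne_top ENNReal.ofReal_ne_top)]

/-- The plane-wave occupations of a continuous `(n+1)`-body function are finite (each is at most
`tr γ_Φ = (n+1) ∫_{Ω^{n+1}} |Φ|² < ∞`). [cite: LSSY2005, §1.2 (1.18)] -/
theorem cellOccupation_planeWaveMode_ne_top (hL : 0 < L) {Φ : Config (n + 1) → ℂ}
    (hΦ : Continuous Φ) (m : Fin 3 → ℤ) :
    cellOccupation (n + 1) L (planeWaveMode L m) Φ ≠ ⊤ := by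
  refine ne_top_of_le_ne_top ?_
    (ENNReal.le_tsum (f := fun p => cellOccupation (n + 1) L (planeWaveMode L p) Φ) m)
  rw [tsum_cellOccupation_planeWaveMode_eq hL hΦ]
  exact ENNReal.mul_ne_top (ENNReal.natCast_ne_top _) (lintegral_cellN_sq_lt_top L hΦ).ne

end Slices

end Summit.AtomisticToContinuum.BoseEinsteinCondensation.Theorems.SubharmonicContinuation

end
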